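import Mathlib.Analysis.Complex.Liouville
import Literature.NumberTheory.LFunctions.TuringMethodTuringBound
import Literature.NumberTheory.LFunctions.ZetaSubOneVerticalSup
import HarnessLib

/-!
# Route JensenLogBand, BAND crux (stmt-RiemannHypothesis-19913) — infrastructure (I2), regime (R1):
# `ζ` far right of the `1`-line is exponentially close to `1` (RH-FREE)

Cell rh-jensen, LADDER-RH rung J-P(P3) «log band»; item (I2) of the BAND lead's LINE-PLAN §1 (R1) / §2
(HOME/rh-jensen-prover/g7-work/LINE-PLAN.md): in the Γ-regime the saddle window sits at abscissa
`σ_w ≥ h₁ ≈ 20`, where `log ζ` and `ζ′/ζ` must be EXPONENTIALLY small (a `1/(σ-1)` bound does not beat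
the window width). Elementary, from the tree's integral test (`re_riemannZeta_ofReal_le_sum_add`,
`N = 2`) and `‖ζ(s) - 1‖ ≤ ζ(σ) - 1` (`norm_riemannZeta_sub_one_le_re_sub_one`), then Cauchy's
inequality on unit discs:

* `re_riemannZeta_ofReal_sub_one_le` — `ζ(σ) - 1 ≤ 3·2^{-σ}` for real `σ ≥ 2`;
* `norm_riemannZeta_sub_one_le_three_mul` — `‖ζ(s) - 1‖ ≤ 3·2^{-Re s}` for `Re s ≥ 2`;
* `norm_deriv_riemannZeta_le_six_mul` — `‖ζ′(s)‖ ≤ 6·2^{-Re s}` for `Re s ≥ 3`;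
* `norm_deriv_riemannZeta_div_le_ten_mul` — `‖ζ′(s)/ζ(s)‖ ≤ 10·2^{-Re s}` for `Re s ≥ 3`.

WHAT THIS IS NOT: bounds for `ζ` in its half-plane of absolute convergence only; nothing here bears
on zeros of `ζ` or the truth of RH. (prover-rh-jensen-eng-2-g5-0, 2026-08-27.)
-/

noncomputable section

open Complex Metric Set

set_option linter.dupNamespace false

namespace Summit.RiemannHypothesis.RiemannHypothesis.Theorems.JensenPolynomials.LogBandArc

open Literature.NumberTheory.LFunctions

/-- **`ζ(σ) - 1 ≤ 3·2^{-σ}` for real `σ ≥ 2`** (integral test with `N = 2`: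
`ζ(σ) ≤ 1 + 2^{-σ} + 2^{1-σ}/(σ-1)` and `2/(σ-1) ≤ 2`). RH-FREE. -/
theorem re_riemannZeta_ofReal_sub_one_le {σ : ℝ} (hσ : 2 ≤ σ) :
    (riemannZeta σ).re - 1 ≤ 3 * (2 : ℝ) ^ (-σ) := by
  have hσ1 : 1 < σ := by linarith
  have h := re_riemannZeta_ofReal_le_sum_add hσ1 (N := 2) (by norm_num)
  have hsum : (∑ n ∈ Finset.range 2, ((n : ℝ) + 1) ^ (-σ)) = 1 + (2 : ℝ) ^ (-σ) := by
    rw [Finset.sum_range_succ, Finset.sum_range_one]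
    norm_num
  rw [hsum] at h
  have h2 : ((2 : ℕ) : ℝ) ^ (1 - σ) / (σ - 1) ≤ 2 * (2 : ℝ) ^ (-σ) := by
    have hpow : ((2 : ℕ) : ℝ) ^ (1 - σ) = 2 * (2 : ℝ) ^ (-σ) := by
      push_cast
      rw [show (1 : ℝ) - σ = 1 + -σ by ring, Real.rpow_add (by norm_num : (0 : ℝ) < 2),
        Real.rpow_one]
    rw [hpow, div_le_iff₀ (by linarith)]
    have h0 : 0 < 2 * (2 : ℝ) ^ (-σ) := by positivity
    nlinarith
  linarith

/-- **`‖ζ(s) - 1‖ ≤ 3·2^{-Re s}` for `Re s ≥ 2`.** RH-FREE. -/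
theorem norm_riemannZeta_sub_one_le_three_mul {s : ℂ} (hs : 2 ≤ s.re) :
    ‖riemannZeta s - 1‖ ≤ 3 * (2 : ℝ) ^ (-s.re) :=
  (norm_riemannZeta_sub_one_le_re_sub_one (by linarith)).trans (re_riemannZeta_ofReal_sub_one_le hs)

/-- Hence `‖ζ(s)‖ ≥ 1 - 3·2^{-Re s}` (`≥ 5/8` for `Re s ≥ 3`). RH-FREE. -/
theorem one_sub_le_norm_riemannZeta {s : ℂ} (hs : 2 ≤ s.re) :
    1 - 3 * (2 : ℝ) ^ (-s.re) ≤ ‖riemannZeta s‖ := by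
  have h := norm_riemannZeta_sub_one_le_three_mul hs
  have h1 : (1 : ℝ) - ‖riemannZeta s - 1‖ ≤ ‖riemannZeta s‖ := by
    have := norm_sub_norm_le (1 : ℂ) (1 - riemannZeta s)
    rw [sub_sub_cancel, norm_one, norm_sub_rev] at this
    linarith
  linarith

/-- **`‖ζ′(s)‖ ≤ 6·2^{-Re s}` for `Re s ≥ 3`** (Cauchy's inequality for `ζ - 1` on the unit circle about
`s`, on which `Re z ≥ Re s - 1 ≥ 2` and `‖ζ(z) - 1‖ ≤ 3·2^{-(Re s - 1)} = 6·2^{-Re s}`). RH-FREE. -/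
theorem norm_deriv_riemannZeta_le_six_mul {s : ℂ} (hs : 3 ≤ s.re) :
    ‖deriv riemannZeta s‖ ≤ 6 * (2 : ℝ) ^ (-s.re) := by
  set g : ℂ → ℂ := fun z ↦ riemannZeta z - 1 with hg
  -- the closed unit disc about `s` lies in `Re z ≥ 2`, away from the pole
  have hre_of_mem : ∀ z ∈ closedBall s 1, s.re - 1 ≤ z.re := by
    intro z hz
    have hz' : ‖z - s‖ ≤ 1 := mem_closedBall_iff_norm.1 hz
    have : |(z - s).re| ≤ 1 := le_trans (Complex.abs_re_le_norm _) hz'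
    rw [Complex.sub_re, abs_le] at this
    linarith [this.1]
  have hne1 : ∀ z ∈ closedBall s 1, z ≠ 1 := by
    intro z hz h1
    have := hre_of_mem z hz
    rw [h1, Complex.one_re] at this
    linarith
  have hdc : DiffContOnCl ℂ g (ball s 1) := by
    refine DifferentiableOn.diffContOnCl ?_
    rw [closure_ball s one_ne_zero]
    intro z hz
    exact ((differentiableAt_riemannZeta (hne1 z hz)).sub_const 1).differentiableWithinAt
  have hC : ∀ z ∈ sphere s 1, ‖g z‖ ≤ 6 * (2 : ℝ) ^ (-s.re) := by
    intro z hz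
    have hzre : s.re - 1 ≤ z.re := hre_of_mem z (sphere_subset_closedBall hz)
    have hz2 : 2 ≤ z.re := by linarith
    calc ‖g z‖ = ‖riemannZeta z - 1‖ := rfl
      _ ≤ 3 * (2 : ℝ) ^ (-z.re) := norm_riemannZeta_sub_one_le_three_mul hz2
      _ ≤ 3 * (2 : ℝ) ^ (-(s.re - 1)) := by
          gcongr
          · linarith
      _ = 6 * (2 : ℝ) ^ (-s.re) := by
          rw [show -(s.re - 1) = 1 + -s.re by ring, Real.rpow_add (by norm_num : (0 : ℝ) < 2),
            Real.rpow_one]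
          ring
  have hest := Complex.norm_deriv_le_of_forall_mem_sphere_norm_le one_pos hdc hC
  rw [div_one] at hest
  have hderiv : deriv g s = deriv riemannZeta s := by
    have hs1 : s ≠ 1 := hne1 s (mem_closedBall_self zero_le_one)
    have h1 : HasDerivAt g (deriv riemannZeta s) s :=
      ((differentiableAt_riemannZeta hs1).hasDerivAt).sub_const (1 : ℂ)
    exact h1.deriv
  rwa [hderiv] at hest

/-- **`‖ζ′(s)/ζ(s)‖ ≤ 10·2^{-Re s}` for `Re s ≥ 3`** (`‖ζ′‖ ≤ 6·2^{-σ}`, `‖ζ‖ ≥ 1 - 3/8 = 5/8`). RH-FREE. -/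
theorem norm_deriv_riemannZeta_div_le_ten_mul {s : ℂ} (hs : 3 ≤ s.re) :
    ‖deriv riemannZeta s / riemannZeta s‖ ≤ 10 * (2 : ℝ) ^ (-s.re) := by
  have hnum := norm_deriv_riemannZeta_le_six_mul hs
  have hden := one_sub_le_norm_riemannZeta (s := s) (by linarith)
  -- `2^{-σ} ≤ 1/8` for `σ ≥ 3`
  have hsmall : (2 : ℝ) ^ (-s.re) ≤ 1 / 8 := by
    calc (2 : ℝ) ^ (-s.re) ≤ (2 : ℝ) ^ (-(3 : ℝ)) := by
          apply Real.rpow_le_rpow_of_exponent_le (by norm_num); linarith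
      _ = 1 / 8 := by
          rw [Real.rpow_neg (by norm_num), show (3 : ℝ) = (3 : ℕ) by norm_num, Real.rpow_natCast]
          norm_num
  have hden' : (5 : ℝ) / 8 ≤ ‖riemannZeta s‖ := by linarith
  have hpos : 0 < ‖riemannZeta s‖ := by linarith
  rw [norm_div, div_le_iff₀ hpos]
  have h2 : 0 ≤ (2 : ℝ) ^ (-s.re) := by positivity
  nlinarith

/-- **`‖Log ζ(s)‖ ≤ (9/2)·2^{-Re s}` for `Re s ≥ 3`** (principal logarithm; `ζ(s) = 1 + u` with
`‖u‖ ≤ 3·2^{-σ} ≤ 3/8 ≤ ½` and Mathlib's `‖log(1+z)‖ ≤ (3/2)‖z‖` for `‖z‖ ≤ ½`). RH-FREE.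
(appended 2026-08-27, same seat) -/
theorem norm_log_riemannZeta_le {s : ℂ} (hs : 3 ≤ s.re) :
    ‖Complex.log (riemannZeta s)‖ ≤ 9 / 2 * (2 : ℝ) ^ (-s.re) := by
  have hu := norm_riemannZeta_sub_one_le_three_mul (s := s) (by linarith)
  have hsmall : (2 : ℝ) ^ (-s.re) ≤ 1 / 8 := by
    calc (2 : ℝ) ^ (-s.re) ≤ (2 : ℝ) ^ (-(3 : ℝ)) := by
          apply Real.rpow_le_rpow_of_exponent_le (by norm_num); linarith
      _ = 1 / 8 := by
          rw [Real.rpow_neg (by norm_num), show (3 : ℝ) = (3 : ℕ) by norm_num, Real.rpow_natCast]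
          norm_num
  have hhalf : ‖riemannZeta s - 1‖ ≤ 1 / 2 := by linarith
  have h := Complex.norm_log_one_add_half_le_self hhalf
  rw [add_sub_cancel] at h
  linarith

end Summit.RiemannHypothesis.RiemannHypothesis.Theorems.JensenPolynomials.LogBandArc
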